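import Summits.AtomisticToContinuum.Crystallization.Theorems.BrittleRungDescentSoftLocalHalesOfHales
import Literature.Geometry.DiscreteGeometry.KissingSearchFinal
import HarnessLib

/-!
# `SoftLocalHales` (route BrittleRungDescent, item stmt-AtomisticToContinuum-10944) — proved

The support statement `SoftLocalHales` of the route (the `η`-tolerant local Hales
classification: in an `η`-perturbed kissing-saturated configuration the contact graph of the
first shell of every point is the FCC or the HCP kissing pattern) follows from Hales's
Theorem 3 with Lemma 9 in graph form, `Hales2012_contactGraphFccOrHcp`
(`softLocalHales_of_contactGraphFccOrHcp`, `BrittleRungDescentSoftLocalHalesOfHales.lean`), and that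
named fact is now PROVED (`Hales2012_contactGraphFccOrHcp_holds`,
`Literature/Geometry/DiscreteGeometry/KissingSearchFinal.lean`: a verified growth search over
labelled fan triangulations, run by `native_decide` — the proof depends on `Lean.ofReduceBool`).
-/

namespace Summit.AtomisticToContinuum.Crystallization.Theorems

/-- **`SoftLocalHales` holds** (item stmt-AtomisticToContinuum-10944 of route BrittleRungDescent):
by `softLocalHales_of_contactGraphFccOrHcp` and the now proved
`Hales2012_contactGraphFccOrHcp_holds`. [cite: Hales2012, Theorem 3 and Lemma 9] -/
theorem SoftLocalHales_proof :
    Summit.AtomisticToContinuum.Crystallization.Theses.BrittleRungDescent.SoftLocalHales :=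
  softLocalHales_of_contactGraphFccOrHcp
    Literature.Geometry.DiscreteGeometry.Hales2012_contactGraphFccOrHcp_holds

end Summit.AtomisticToContinuum.Crystallization.Theorems
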